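import Literature.NumberTheory.Automorphic.UnitaryGroupTruncatedKernelClassHyperbolicTwo
import Literature.NumberTheory.Automorphic.UnitaryGroupAdelicCenterRational
import HarnessLib

/-!
# A non-central element of the class `(X − z)²` of `U(J₂)(F)` lies in exactly one rational Borel subgroup
(Rogawski, *Automorphic Representations of Unitary Groups in Three Variables* (1990), Prop. 3.9.1 p. 32 and proof
of Prop. 7.2.1 pp. 91–92: «every unipotent element in `G` is conjugate to an element of `N`» and «`h` lies in `B`.
For if `h ∉ B`, then `h = bwb′` … `h⁻¹Nh ∩ N = w⁻¹Nw ∩ N = {1}`. Hence `δ` is unique modulo `B_γ`»; Prop. 7.3.1 p. 98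
treats `G = U(2)` by the same token — here the rank-one group `U(J₂) = U(Φ₂)` itself.)

Topic `NumberTheory/Automorphic`; namespace `Literature.NumberTheory.Automorphic.UnitaryGroup`. THEOREMS ONLY over
accepted tree modules (no definition, no named fact, no instance, no notation, no `sorry`). The `N = 2` twin of ★
`UnitaryGroupUnipotentRationalBorel` ⊕ ★ `UnitaryGroupUnipotentRationalBorelUnique` (H-side copy of the LAW trunk of
`Cruxes/H413/Lines/F0_T1InnerFormTraceIdentity.lean` for `H = U(Φ₂) × U(Φ₁)`; cell hodgecm-mathlib, crux H413;
CENSUS-LAWS-Hside §3 LAW 5 (σ-u)). Setting: `G = U(J₂)` (★ `quasiSplit F E c 2`), `B(F) =` ★ `arithmeticBorel`,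
the hermitian pairing `⟨ξ, η⟩ = Σ_i ξ_i c(η_{rev i})` on row vectors, the CENTRAL × UNIPOTENT class
`{γ ∈ G(F) : charpoly γ = (X − z)² ⊗ 𝔸_E}`, `z ∈ E¹` (`z = 1`: the unipotent elements; ★
`UnitaryGroupCharpolyBorelClassesTwo`, the central branch of the dichotomy).

* §1 (EVERY `N`) `sum_mul_conj_rev_eq_zero_of_vecMul_eq_smul_fin` — isotropy of a `z`-eigen-row of the form
  `ξ = aγ − z a` (`z ∈ E¹`), over ★ `sum_vecMul_mul_conj_vecMul_rev_fin`.
* §2 (`N = 2`, EXISTENCE) `exists_isotropic_vecMul_eq_smul_of_charpoly_eq_sq_two` — a rational `γ ≠ z·1` with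
  `charpoly γ = (X − z)²` has a non-zero isotropic `z`-eigen-row (a non-zero row of `Y = γ − z·1`, `Y² = 0` by
  Cayley–Hamilton); **`forall_exists_conj_mem_arithmeticBorel_of_charpoly_eq_sq_two`** — EVERY rational element of
  the class `(X − z)²` is `G(F)`-conjugate into `B(F)` (★ `exists_conj_mem_arithmeticBorel_of_vecMul_eq_smul_two`).
* §3 (`N = 2`, UNIQUENESS) `apply_self_eq_of_blockTriangular_of_charpoly_eq_sq_two` (an upper triangular element of
  the class has diagonal `(z, z)`), `eq_smul_single_of_vecMul_eq_smul_two` (a non-central `β ∈ B(F)` of the class fixes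
  ONLY the line `E e₂`: `ξ β = z ξ ⇒ ξ = ξ₁ e₂` — for `2 × 2` no isotropy is needed),
  **`mem_arithmeticBorel_of_conj_mem_of_conj_mem_two`** — if `δ₁γδ₁⁻¹, δ₂γδ₂⁻¹ ∈ B(F)` for a non-central `γ` of the
  class then `δ₂δ₁⁻¹ ∈ B(F)` («`δ` is unique modulo `B_γ = B`»).

## References

* J. D. Rogawski, *Automorphic Representations of Unitary Groups in Three Variables*, Annals of Mathematics Studies
  123 (1990), Prop. 3.9.1 (p. 32), Prop. 7.2.1 (pp. 91–92), Prop. 7.3.1 (p. 98) [Rogawski1990].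
* J. Arthur, *A trace formula for reductive groups I*, Duke Math. J. 45 (1978), §8 [Arthur1978TraceFormulaI].
-/

set_option autoImplicit false

noncomputable section

open NumberField IsDedekindDomain Matrix Polynomial
open scoped MatrixGroups

namespace Literature.NumberTheory.Automorphic

namespace UnitaryGroup

variable {F E : Type} [Field F] [NumberField F] [Field E] [NumberField E] [Algebra F E]
  {c : E ≃ₐ[F] E} {N : ℕ}

/-! ## §1 Every `N`: isotropy of a `z`-eigen-row `ξ = aγ − z a` -/

omit [NumberField F] [NumberField E] in
/-- Row `a` of a product: `(A * B) a = A a ᵥ* B` (private plumbing). [folklore] -/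
private theorem row_vecMul' {n : ℕ} (A B : Matrix (Fin n) (Fin n) E) (a : Fin n) :
    (fun k => (A * B) a k) = (fun k => A a k) ᵥ* B := by
  funext k
  simp only [Matrix.vecMul, dotProduct, Matrix.mul_apply]

/-- **Isotropy from an eigen-row** (every `N`): for `γ ∈ U(J_N)(F)`, `z ∈ E¹` and rows `a, ξ` with `ξ = a γ − z a` and
`ξ γ = z ξ`, the row `ξ` is ISOTROPIC: `⟨ξ, ξ⟩ = ⟨aγ, ξ⟩ − z⟨a, ξ⟩` and `⟨aγ, ξ⟩ = z c(z) ⟨aγ, ξ⟩ = z ⟨aγ, ξγ⟩ = z ⟨a, ξ⟩`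
(★ `sum_vecMul_mul_conj_vecMul_rev_fin`); the rank-free form of ★ `sum_mul_conj_rev_eq_zero_of_vecMul_eq_smul`.
[cite: Rogawski1990, Prop. 3.9.1 (p. 32)] -/
theorem sum_mul_conj_rev_eq_zero_of_vecMul_eq_smul_fin (γ : (quasiSplit F E c N).Rational) {z : E}
    (hz : c z * z = 1) {a ξ : Fin N → E}
    (hξ : ξ = a ᵥ* ((γ.1 : GL (Fin N) E) : Matrix (Fin N) (Fin N) E) - z • a)
    (heig : ξ ᵥ* ((γ.1 : GL (Fin N) E) : Matrix (Fin N) (Fin N) E) = z • ξ) :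
    ∑ i, ξ i * c (ξ (Fin.rev i)) = 0 := by
  set M : Matrix (Fin N) (Fin N) E := ((γ.1 : GL (Fin N) E) : Matrix (Fin N) (Fin N) E) with hM
  -- `⟨aM, ξ⟩ = z ⟨a, ξ⟩`
  have hinv := sum_vecMul_mul_conj_vecMul_rev_fin γ a ξ
  rw [← hM, heig] at hinv
  simp only [Pi.smul_apply, smul_eq_mul, map_mul] at hinv
  have h1 : ∑ i, (a ᵥ* M) i * c (ξ (Fin.rev i)) = z * ∑ i, a i * c (ξ (Fin.rev i)) := by
    rw [← hinv, Finset.mul_sum]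
    refine Finset.sum_congr rfl fun i _ => ?_
    calc (a ᵥ* M) i * c (ξ (Fin.rev i)) = (z * c z) * ((a ᵥ* M) i * c (ξ (Fin.rev i))) := by
          rw [mul_comm z, hz, one_mul]
      _ = z * ((a ᵥ* M) i * (c z * c (ξ (Fin.rev i)))) := by ring
  -- expand the left slot `ξ = aM − z a`
  have hξi : ∀ i, ξ i = (a ᵥ* M) i - z * a i := fun i => by
    rw [hξ]; simp only [Pi.sub_apply, Pi.smul_apply, smul_eq_mul]
  calc ∑ i, ξ i * c (ξ (Fin.rev i)) = ∑ i, ((a ᵥ* M) i - z * a i) * c (ξ (Fin.rev i)) :=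
        Finset.sum_congr rfl fun i _ => by rw [hξi i]
    _ = ∑ i, (a ᵥ* M) i * c (ξ (Fin.rev i)) - z * ∑ i, a i * c (ξ (Fin.rev i)) := by
        simp only [sub_mul, Finset.sum_sub_distrib, mul_assoc, Finset.mul_sum]
    _ = 0 := by rw [h1, sub_self]

/-! ## §2 `U(J₂)`, existence: every element of the class `(X − z)²` is `G(F)`-conjugate into `B(F)` -/

omit [NumberField F] [NumberField E] in
/-- Cayley–Hamilton for the class `(X − z)²`: `(γ − z·1)² = 0`. [cite: Rogawski1990, §3.9 (p. 32)] -/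
private theorem sub_smul_one_sq_eq_zero {M : Matrix (Fin 2) (Fin 2) E} {z : E}
    (hchar : M.charpoly = (X - C z) ^ 2) : (M - z • (1 : Matrix (Fin 2) (Fin 2) E)) ^ 2 = 0 := by
  have h := Matrix.aeval_self_charpoly M
  rw [hchar, map_pow, map_sub, Polynomial.aeval_X, Polynomial.aeval_C, Algebra.algebraMap_eq_smul_one] at h
  exact h

omit [NumberField F] [NumberField E] in
/-- A row annihilated by `Y = γ − z·1` is a `z`-eigen-row of `γ`. [cite: Rogawski1990, §3.9 (p. 32)] -/
private theorem vecMul_eq_smul_of_vecMul_sub_eq_zero' {n : ℕ} {M : Matrix (Fin n) (Fin n) E} {z : E}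
    {ξ : Fin n → E} (h : ξ ᵥ* (M - z • (1 : Matrix (Fin n) (Fin n) E)) = 0) : ξ ᵥ* M = z • ξ := by
  rw [Matrix.vecMul_sub, sub_eq_zero, Matrix.vecMul_smul, Matrix.vecMul_one] at h
  exact h

/-- **A RATIONAL `γ ≠ z·1` OF `U(J₂)` WITH `charpoly γ = (X − z)²` (`z ∈ E¹`) HAS A NON-ZERO ISOTROPIC `z`-EIGEN-ROW**
`ξ ≠ 0`, `⟨ξ, ξ⟩ = 0`, `ξ γ = z ξ`: with `Y = γ − z·1`, `Y² = 0` (Cayley–Hamilton), take `ξ` a non-zero row of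
`Y = (row of 1)·Y`; then `ξ Y = (row of Y²) = 0` and §1 gives the isotropy. For `z = 1`: every unipotent `u ≠ 1` of
`U(J₂)(F)` fixes a non-zero isotropic vector (Rogawski (1990), Prop. 3.9.1, rank one). [cite: Rogawski1990, Prop. 3.9.1 (p. 32)] -/
theorem exists_isotropic_vecMul_eq_smul_of_charpoly_eq_sq_two (γ : (quasiSplit F E c 2).Rational) {z : E}
    (hz : c z * z = 1) (hchar : ((γ.1 : GL (Fin 2) E) : Matrix (Fin 2) (Fin 2) E).charpoly = (X - C z) ^ 2)
    (hne : ((γ.1 : GL (Fin 2) E) : Matrix (Fin 2) (Fin 2) E) ≠ z • (1 : Matrix (Fin 2) (Fin 2) E)) :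
    ∃ ξ : Fin 2 → E, ξ ≠ 0 ∧ ∑ i, ξ i * c (ξ (Fin.rev i)) = 0 ∧
      ξ ᵥ* ((γ.1 : GL (Fin 2) E) : Matrix (Fin 2) (Fin 2) E) = z • ξ := by
  set M : Matrix (Fin 2) (Fin 2) E := ((γ.1 : GL (Fin 2) E) : Matrix (Fin 2) (Fin 2) E) with hM
  set Y : Matrix (Fin 2) (Fin 2) E := M - z • (1 : Matrix (Fin 2) (Fin 2) E) with hY
  have hY2 : Y * Y = 0 := by rw [← sq]; exact sub_smul_one_sq_eq_zero hchar
  have hY0 : Y ≠ 0 := fun h => hne (sub_eq_zero.1 h)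
  -- `ξ` = a non-zero row of `Y`
  obtain ⟨i, j, hij⟩ : ∃ i j, Y i j ≠ 0 := by
    by_contra h
    push Not at h
    exact hY0 (Matrix.ext fun i j => h i j)
  -- `ξ ᵥ* Y` is the `i`-th row of `Y² = 0`
  have hξY : (fun k => Y i k) ᵥ* Y = 0 := by
    funext k
    have h := congrFun (congrFun hY2 i) k
    rw [Matrix.mul_apply] at h
    simpa only [Matrix.vecMul, dotProduct, Matrix.zero_apply, Pi.zero_apply] using h
  -- `ξ = e_i ᵥ* M − z e_i`
  have hξa : (fun k => Y i k) = (fun k => (1 : Matrix (Fin 2) (Fin 2) E) i k) ᵥ* M -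
      z • (fun k => (1 : Matrix (Fin 2) (Fin 2) E) i k) := by
    funext k
    have h1 : ((fun k => (1 : Matrix (Fin 2) (Fin 2) E) i k) ᵥ* M) k = M i k := by
      have h := (Matrix.one_mul M).symm
      have hk := congrFun (congrFun h i) k
      rw [Matrix.mul_apply] at hk
      simpa only [Matrix.vecMul, dotProduct] using hk.symm
    rw [Pi.sub_apply, Pi.smul_apply, h1, hY, Matrix.sub_apply, Matrix.smul_apply, smul_eq_mul]
  refine ⟨fun k => Y i k, fun h => hij (by simpa using congrFun h j), ?_, ?_⟩
  · exact sum_mul_conj_rev_eq_zero_of_vecMul_eq_smul_fin γ hz hξa (vecMul_eq_smul_of_vecMul_sub_eq_zero' hξY)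
  · exact vecMul_eq_smul_of_vecMul_sub_eq_zero' hξY

/-- **EVERY RATIONAL ELEMENT OF THE CLASS `(X − z)²` OF `U(J₂)`, `z ∈ E¹`, IS `G(F)`-CONJUGATE INTO THE RATIONAL BOREL**:
if `charpoly γ = (X − z)² ⊗ 𝔸_E` then `δ γ δ⁻¹ ∈ B(F)` for some `δ ∈ G(F)` (`γ = z·1`: `δ = 1`; else §2's isotropic
`z`-eigen-row and ★ `exists_conj_mem_arithmeticBorel_of_vecMul_eq_smul_two` — Witt + «`B` = stabiliser of `E e₂`»). For
`z = 1`: every unipotent element of `U(J₂)(F)` lies in a rational Borel subgroup (Rogawski (1990), Prop. 3.9.1). The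
letter `hB` of the central branch of the `U(J₂)` dichotomy. [cite: Rogawski1990, Prop. 3.9.1 (p. 32)]
[cite: Rogawski1990, Prop. 7.3.1 (p. 98)] -/
theorem forall_exists_conj_mem_arithmeticBorel_of_charpoly_eq_sq_two {z : E} (hz : c z * z = 1) :
    ∀ γ : (quasiSplit F E c 2).arithmeticSubgroup,
      ((adelicVal F E c 2 _ (γ : (quasiSplit F E c 2).Adelic) : GL (Fin 2) (AdeleRing (𝓞 E) E)) :
          Matrix (Fin 2) (Fin 2) (AdeleRing (𝓞 E) E)).charpoly =
        ((X - C z) ^ 2).map (algebraMap E (AdeleRing (𝓞 E) E)) →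
      ∃ δ : (quasiSplit F E c 2).arithmeticSubgroup, δ * γ * δ⁻¹ ∈ arithmeticBorel F E c 2 := by
  intro γ hchar
  obtain ⟨γ₀, hγ₀⟩ := γ.2
  have hchar₀ : ((γ₀.1 : GL (Fin 2) E) : Matrix (Fin 2) (Fin 2) E).charpoly = (X - C z) ^ 2 := by
    rw [← hγ₀, charpoly_adelicVal_toAdelic] at hchar
    exact Polynomial.map_injective _ (AdeleRing.algebraMap_injective (𝓞 E) E) hchar
  by_cases hcen : ((γ₀.1 : GL (Fin 2) E) : Matrix (Fin 2) (Fin 2) E) = z • (1 : Matrix (Fin 2) (Fin 2) E)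
  · -- `γ = z·1` is diagonal, hence in `B(F)`
    refine ⟨1, ?_⟩
    rw [one_mul, inv_one, mul_one, mem_arithmeticBorel_iff, ← hγ₀, toAdelic_mem_borelAdelic_iff, hcen]
    intro i j hij
    have hij' : i ≠ j := ne_of_gt hij
    simp [hij']
  · obtain ⟨ξ, hξ0, hiso, heig⟩ := exists_isotropic_vecMul_eq_smul_of_charpoly_eq_sq_two γ₀ hz hchar₀ hcen
    obtain ⟨δ, hδ⟩ := exists_conj_mem_arithmeticBorel_of_vecMul_eq_smul_two γ₀ hξ0 hiso heig
    refine ⟨⟨(quasiSplit F E c 2).toAdelic δ, δ, rfl⟩, ?_⟩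
    rw [mem_arithmeticBorel_iff]
    have hval : (((⟨(quasiSplit F E c 2).toAdelic δ, δ, rfl⟩ : (quasiSplit F E c 2).arithmeticSubgroup) * γ *
        (⟨(quasiSplit F E c 2).toAdelic δ, δ, rfl⟩ : (quasiSplit F E c 2).arithmeticSubgroup)⁻¹ :
          (quasiSplit F E c 2).arithmeticSubgroup) : (quasiSplit F E c 2).Adelic) =
        (quasiSplit F E c 2).toAdelic (δ * γ₀ * δ⁻¹) := by
      rw [map_mul, map_mul, map_inv, hγ₀]
      rfl
    rw [hval]
    exact hδ

/-! ## §3 `U(J₂)`, uniqueness: the rational Borel subgroup through a non-central element of the class is unique -/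

omit [NumberField F] [NumberField E] in
/-- An upper triangular `2 × 2` matrix with `charpoly = (X − z)²` has diagonal `(z, z)` (Mathlib
`Matrix.charpoly_of_upperTriangular`). [cite: Rogawski1990, §1.9 (p. 9)] -/
theorem apply_self_eq_of_blockTriangular_of_charpoly_eq_sq_two {B : Matrix (Fin 2) (Fin 2) E}
    (hB : B.BlockTriangular id) {z : E} (hchar : B.charpoly = (X - C z) ^ 2) (i : Fin 2) : B i i = z := by
  have h := Matrix.charpoly_of_upperTriangular B hB
  rw [hchar] at h
  have h0 : ((X - C z) ^ 2 : E[X]).eval (B i i) = 0 := by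
    rw [h, Polynomial.eval_prod]
    exact Finset.prod_eq_zero (Finset.mem_univ i) (by simp)
  simp only [eval_pow, eval_sub, eval_X, eval_C] at h0
  exact sub_eq_zero.1 (pow_eq_zero_iff (by norm_num) |>.1 h0)

/-- **A NON-CENTRAL `β ∈ B(F)` OF THE CLASS `(X − z)²` FIXES ONLY THE LINE `E e₂`**: if `ξ ᵥ* β = z • ξ` then `ξ = ξ₁ e₂`.
Entrywise `β = [[z, x], [0, z]]` with `x ≠ 0` (`β ≠ z·1`), and the eigen-equation in the second slot reads
`ξ₀ x + ξ₁ z = z ξ₁`, i.e. `ξ₀ x = 0`, so `ξ₀ = 0` — at `N = 2` NO isotropy is needed (contrast ★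
`eq_smul_single_of_vecMul_eq_smul` for `U(J₃)`). [cite: Rogawski1990, §3.9 (p. 32)] -/
theorem eq_smul_single_of_vecMul_eq_smul_two (γ : (quasiSplit F E c 2).Rational)
    (hB : ((γ.1 : GL (Fin 2) E) : Matrix (Fin 2) (Fin 2) E).BlockTriangular id) {z : E}
    (hchar : ((γ.1 : GL (Fin 2) E) : Matrix (Fin 2) (Fin 2) E).charpoly = (X - C z) ^ 2)
    (hne : ((γ.1 : GL (Fin 2) E) : Matrix (Fin 2) (Fin 2) E) ≠ z • (1 : Matrix (Fin 2) (Fin 2) E)) {ξ : Fin 2 → E}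
    (heig : ξ ᵥ* ((γ.1 : GL (Fin 2) E) : Matrix (Fin 2) (Fin 2) E) = z • ξ) :
    ξ = ξ ⊤ • Pi.single (⊤ : Fin 2) (1 : E) := by
  set B : Matrix (Fin 2) (Fin 2) E := ((γ.1 : GL (Fin 2) E) : Matrix (Fin 2) (Fin 2) E) with hBdef
  have hd : ∀ i, B i i = z := apply_self_eq_of_blockTriangular_of_charpoly_eq_sq_two hB hchar
  have h10 : B 1 0 = 0 := hB (show ((0 : Fin 2) : Fin 2) < 1 by decide)
  -- `β ≠ z·1` forces `β₀₁ ≠ 0`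
  have h01 : B 0 1 ≠ 0 := by
    intro h01
    apply hne
    ext i j
    fin_cases i <;> fin_cases j <;> simp [hd, h10, h01]
  -- the eigen-equation in slot `1`: `ξ₀ β₀₁ + ξ₁ β₁₁ = z ξ₁`
  have e1 := congrFun heig 1
  simp only [Matrix.vecMul, dotProduct, Fin.sum_univ_two, Pi.smul_apply, smul_eq_mul, hd] at e1
  have hξ0 : ξ 0 = 0 := by
    have h : ξ 0 * B 0 1 = 0 := by linear_combination e1
    exact (mul_eq_zero.1 h).resolve_right h01
  have htop : (⊤ : Fin 2) = 1 := rfl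
  funext j
  fin_cases j
  · simp [htop, hξ0]
  · simp [htop]

/-- Row `⊤` of a product of rational points (private plumbing). [folklore] -/
private theorem ratLastRow_mul_two (p q : (quasiSplit F E c 2).Rational) :
    (fun j : Fin 2 => (((p * q : (quasiSplit F E c 2).Rational).1 : GL (Fin 2) E) : Matrix (Fin 2) (Fin 2) E) ⊤ j) =
      (fun j : Fin 2 => ((p.1 : GL (Fin 2) E) : Matrix (Fin 2) (Fin 2) E) ⊤ j) ᵥ*
        ((q.1 : GL (Fin 2) E) : Matrix (Fin 2) (Fin 2) E) := by
  have h : ((p * q : (quasiSplit F E c 2).Rational).1 : GL (Fin 2) E) = (p.1 : GL (Fin 2) E) * (q.1 : GL (Fin 2) E) := rfl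
  rw [h, Units.val_mul]
  exact row_vecMul' _ _ ⊤

/-- `e₂ ᵥ* M` is the row `⊤` of `M` (private plumbing). [folklore] -/
private theorem ratLastRow_eq_single_vecMul_two (p : (quasiSplit F E c 2).Rational) :
    (fun j : Fin 2 => ((p.1 : GL (Fin 2) E) : Matrix (Fin 2) (Fin 2) E) ⊤ j) =
      Pi.single (⊤ : Fin 2) (1 : E) ᵥ* ((p.1 : GL (Fin 2) E) : Matrix (Fin 2) (Fin 2) E) := by
  rw [Matrix.single_one_vecMul]; rfl

/-- **THE RATIONAL BOREL SUBGROUP CONTAINING A NON-CENTRAL ELEMENT OF THE CLASS `(X − z)²` OF `U(J₂)` IS UNIQUE**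
(`z ∈ E¹`): if `δ₁ γ δ₁⁻¹ ∈ B(F)` and `δ₂ γ δ₂⁻¹ ∈ B(F)` then `δ₂ δ₁⁻¹ ∈ B(F)`, i.e. `B(F)δ₁ = B(F)δ₂`. With
`β = δ₁ γ δ₁⁻¹ ∈ B(F)` and `h = δ₂ δ₁⁻¹`: `h β h⁻¹ ∈ B(F)` has last row `z e₂`, so the row `e₂ h` satisfies
`(e₂ h) β = z (e₂ h)`, hence is a multiple of `e₂` (`eq_smul_single_of_vecMul_eq_smul_two`), and `h` stabilises `E e₂`
(★ `mem_borelAdelic_toAdelic_of_lastRow_eq_smul_two`) — «`δ` is unique modulo `B_γ`» (Rogawski (1990), proof of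
Prop. 7.2.1) at the central class of `U(2)` where `B_γ = B`. [cite: Rogawski1990, Prop. 7.2.1 (pp. 91–92)]
[cite: Rogawski1990, Prop. 7.3.1 (p. 98)] -/
theorem mem_arithmeticBorel_of_conj_mem_of_conj_mem_two {z : E}
    {γ δ₁ δ₂ : (quasiSplit F E c 2).arithmeticSubgroup}
    (hchar : ((adelicVal F E c 2 _ (γ : (quasiSplit F E c 2).Adelic) : GL (Fin 2) (AdeleRing (𝓞 E) E)) :
        Matrix (Fin 2) (Fin 2) (AdeleRing (𝓞 E) E)).charpoly =
      ((X - C z) ^ 2).map (algebraMap E (AdeleRing (𝓞 E) E)))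
    (hne : ((adelicVal F E c 2 _ (γ : (quasiSplit F E c 2).Adelic) : GL (Fin 2) (AdeleRing (𝓞 E) E)) :
        Matrix (Fin 2) (Fin 2) (AdeleRing (𝓞 E) E)) ≠
      algebraMap E (AdeleRing (𝓞 E) E) z • (1 : Matrix (Fin 2) (Fin 2) (AdeleRing (𝓞 E) E)))
    (h₁ : δ₁ * γ * δ₁⁻¹ ∈ arithmeticBorel F E c 2) (h₂ : δ₂ * γ * δ₂⁻¹ ∈ arithmeticBorel F E c 2) :
    δ₂ * δ₁⁻¹ ∈ arithmeticBorel F E c 2 := by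
  obtain ⟨γ₀, hγ₀⟩ := γ.2
  obtain ⟨d₁, hd₁⟩ := δ₁.2
  obtain ⟨d₂, hd₂⟩ := δ₂.2
  have hchar₀ : ((γ₀.1 : GL (Fin 2) E) : Matrix (Fin 2) (Fin 2) E).charpoly = (X - C z) ^ 2 := by
    have h := hchar
    rw [← hγ₀, charpoly_adelicVal_toAdelic] at h
    exact Polynomial.map_injective _ (AdeleRing.algebraMap_injective (𝓞 E) E) h
  -- rational avatars
  set β₀ : (quasiSplit F E c 2).Rational := d₁ * γ₀ * d₁⁻¹ with hβ₀
  set h₀ : (quasiSplit F E c 2).Rational := d₂ * d₁⁻¹ with hh₀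
  have hβ₀A : (quasiSplit F E c 2).toAdelic β₀ = ((δ₁ * γ * δ₁⁻¹ : (quasiSplit F E c 2).arithmeticSubgroup) :
      (quasiSplit F E c 2).Adelic) := by
    rw [hβ₀, map_mul, map_mul, map_inv, hγ₀, hd₁]; rfl
  have hh₀A : (quasiSplit F E c 2).toAdelic h₀ = ((δ₂ * δ₁⁻¹ : (quasiSplit F E c 2).arithmeticSubgroup) :
      (quasiSplit F E c 2).Adelic) := by
    rw [hh₀, map_mul, map_inv, hd₁, hd₂]; rfl
  have hκA : (quasiSplit F E c 2).toAdelic (h₀ * β₀ * h₀⁻¹) =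
      ((δ₂ * γ * δ₂⁻¹ : (quasiSplit F E c 2).arithmeticSubgroup) : (quasiSplit F E c 2).Adelic) := by
    have : h₀ * β₀ * h₀⁻¹ = d₂ * γ₀ * d₂⁻¹ := by rw [hh₀, hβ₀]; group
    rw [this, map_mul, map_mul, map_inv, hγ₀, hd₂]; rfl
  -- `β₀` and `h₀ β₀ h₀⁻¹` are upper triangular with `charpoly = (X − z)²`
  have hβB : ((β₀.1 : GL (Fin 2) E) : Matrix (Fin 2) (Fin 2) E).BlockTriangular id :=
    (toAdelic_mem_borelAdelic_iff β₀).1 (by rw [hβ₀A]; exact (mem_arithmeticBorel_iff _).1 h₁)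
  have hκB : (((h₀ * β₀ * h₀⁻¹ : (quasiSplit F E c 2).Rational).1 : GL (Fin 2) E) :
      Matrix (Fin 2) (Fin 2) E).BlockTriangular id :=
    (toAdelic_mem_borelAdelic_iff _).1 (by rw [hκA]; exact (mem_arithmeticBorel_iff _).1 h₂)
  have hβchar : ((β₀.1 : GL (Fin 2) E) : Matrix (Fin 2) (Fin 2) E).charpoly = (X - C z) ^ 2 := by
    rw [← hchar₀, hβ₀]
    change (((d₁.1 : GL (Fin 2) E) : Matrix (Fin 2) (Fin 2) E) * ((γ₀.1 : GL (Fin 2) E) : Matrix (Fin 2) (Fin 2) E) *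
      (((d₁.1 : GL (Fin 2) E)⁻¹ : GL (Fin 2) E) : Matrix (Fin 2) (Fin 2) E)).charpoly = _
    rw [Matrix.coe_units_inv]
    exact Matrix.charpoly_units_conj _ _
  have hκchar : (((h₀ * β₀ * h₀⁻¹ : (quasiSplit F E c 2).Rational).1 : GL (Fin 2) E) :
      Matrix (Fin 2) (Fin 2) E).charpoly = (X - C z) ^ 2 := by
    rw [← hβchar]
    change (((h₀.1 : GL (Fin 2) E) : Matrix (Fin 2) (Fin 2) E) * ((β₀.1 : GL (Fin 2) E) : Matrix (Fin 2) (Fin 2) E) *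
      (((h₀.1 : GL (Fin 2) E)⁻¹ : GL (Fin 2) E) : Matrix (Fin 2) (Fin 2) E)).charpoly = _
    rw [Matrix.coe_units_inv]
    exact Matrix.charpoly_units_conj _ _
  -- `β₀ ≠ z·1` (else `γ` would be central)
  have hβne : ((β₀.1 : GL (Fin 2) E) : Matrix (Fin 2) (Fin 2) E) ≠ z • (1 : Matrix (Fin 2) (Fin 2) E) := by
    intro hcen
    apply hne
    have hγ₀mat : ((γ₀.1 : GL (Fin 2) E) : Matrix (Fin 2) (Fin 2) E) = z • (1 : Matrix (Fin 2) (Fin 2) E) := by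
      have hγeq : γ₀ = d₁⁻¹ * β₀ * d₁ := by rw [hβ₀]; group
      rw [hγeq]
      change ((d₁.1 : GL (Fin 2) E)⁻¹ : GL (Fin 2) E) * ((β₀.1 : GL (Fin 2) E) : Matrix (Fin 2) (Fin 2) E) *
        ((d₁.1 : GL (Fin 2) E) : Matrix (Fin 2) (Fin 2) E) = _
      rw [hcen, Matrix.mul_smul, Matrix.mul_one, Matrix.smul_mul, Matrix.coe_units_inv,
        Matrix.nonsing_inv_mul _ ((Matrix.isUnits_det_units _))]
    rw [← hγ₀]
    change (((γ₀.1 : GL (Fin 2) E) : Matrix (Fin 2) (Fin 2) E)).map (algebraMap E (AdeleRing (𝓞 E) E)) = _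
    rw [hγ₀mat, Matrix.smul_one_eq_diagonal, Matrix.diagonal_map (map_zero _), Matrix.smul_one_eq_diagonal]
  -- last row of `h₀ β₀ h₀⁻¹` is `z e₂`
  have hκrow : (fun j : Fin 2 => (((h₀ * β₀ * h₀⁻¹ : (quasiSplit F E c 2).Rational).1 : GL (Fin 2) E) :
      Matrix (Fin 2) (Fin 2) E) ⊤ j) = z • Pi.single (⊤ : Fin 2) (1 : E) := by
    have htop : (⊤ : Fin 2) = 1 := rfl
    have h11 := apply_self_eq_of_blockTriangular_of_charpoly_eq_sq_two hκB hκchar 1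
    have h10 := hκB (show ((0 : Fin 2) : Fin 2) < 1 by decide)
    funext j
    fin_cases j
    · simpa [htop, Pi.single_apply] using h10
    · simpa [htop, Pi.single_apply] using h11
  -- hence `(e₂ h₀) β₀ = z (e₂ h₀)`
  set ξ : Fin 2 → E := fun j => ((h₀.1 : GL (Fin 2) E) : Matrix (Fin 2) (Fin 2) E) ⊤ j with hξ
  have heig : ξ ᵥ* ((β₀.1 : GL (Fin 2) E) : Matrix (Fin 2) (Fin 2) E) = z • ξ := by
    have h := hκrow
    rw [ratLastRow_mul_two, ratLastRow_mul_two] at h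
    -- `h : (ξ ᵥ* β₀) ᵥ* h₀⁻¹ = z • e₂`; multiply by `h₀` on the right
    have h' := congrArg (fun v => v ᵥ* ((h₀.1 : GL (Fin 2) E) : Matrix (Fin 2) (Fin 2) E)) h
    rw [Matrix.vecMul_vecMul, Matrix.smul_vecMul, ← ratLastRow_eq_single_vecMul_two] at h'
    have hinv : ((((h₀⁻¹ : (quasiSplit F E c 2).Rational)).1 : GL (Fin 2) E) : Matrix (Fin 2) (Fin 2) E) *
        ((h₀.1 : GL (Fin 2) E) : Matrix (Fin 2) (Fin 2) E) = 1 := by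
      rw [← Units.val_mul]
      change (((h₀⁻¹ * h₀ : (quasiSplit F E c 2).Rational)).1 : GL (Fin 2) E) = (1 : Matrix (Fin 2) (Fin 2) E)
      rw [inv_mul_cancel]; rfl
    rw [hinv, Matrix.vecMul_one] at h'
    exact h'
  have hrow := eq_smul_single_of_vecMul_eq_smul_two β₀ hβB hβchar hβne heig
  rw [mem_arithmeticBorel_iff, ← hh₀A]
  exact mem_borelAdelic_toAdelic_of_lastRow_eq_smul_two (a := ξ ⊤) hrow

end UnitaryGroup

end Literature.NumberTheory.Automorphic

end
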